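import Mathlib
import Literature.Computability.Complexity.RangeAvoidance
import Literature.Computability.Complexity.SignDegreeXor
import Summits.PneNP.PneNP.Theorems.PstarTyped

/-!
# Typed pure `P⋆` instances: the cut space is the orthogonal of the cycle space, and AVOID through cycles

FRONTIER range-avoidance ladder, roof F-N3 (cell `pnp-ideate`, ROUND-20 SEED §8b; restricted-model algorithmics — nothing
here bears on `P` vs `NP`).

For a TYPED pure `P⋆` instance `PstarTyped.mem_range_typed_iff` gives `Range = Cut(G_L) ⊕ Clique(G_A)`: `y` is a value iff
`y ⊕ cliqueVec S` is a cut vector of the XOR multigraph `G_L` (edge `j` = `{a_j, b_j}`) for some vertex set `S` of the AND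
graph.  Over `𝔽₂` the cut vectors are the coboundaries `(δw)_j = w_{a_j} + w_{b_j}` and the CYCLES (even edge sets) are the
vectors `λ` with zero boundary `(∂λ)_v = Σ_{j ∋ v} λ_j`; this file proves the duality
`Cut(G_L) = Cycle(G_L)^⊥` (`mem_range_coboundary_iff_orth`: `⟪δw, λ⟫ = ⟪w, ∂λ⟫`, and the converse by a separating linear
functional) and hence the CYCLE FORM of typed range membership and avoidance:

* `mem_range_typed_iff_cycle`: `y ∈ Range ↔ ∃ S, ∀ cycles λ, ⟪y ⊕ cliqueVec S, λ⟫ = 0`;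
* `not_mem_range_typed_iff_cycle`: `y ∉ Range ↔ ∀ S, ∃ cycle λ, ⟪y ⊕ cliqueVec S, λ⟫ = 1`.

So after the typed reduction the XOR layer quotients out exactly: typed `P⋆`-AVOID is avoidance for the quadratic map
`S ↦ (⟪cliqueVec S, λ⟫)_{λ ∈ cycle basis}` over `𝔽₂` (ROUND-20 SEED §8b's `Φ_I`).
-/

set_option linter.dupNamespace false

open Finset Literature.Computability.Complexity
open Summit.PneNP.PneNP.Theorems.PstarTyped (Typed cutVec cliqueVec mem_range_typed_iff)

namespace Summit.PneNP.PneNP.Theorems.PstarTypedCycle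

variable {n m : ℕ}

/-! ## Booleans as elements of `𝔽₂` -/

/-- `Bool → 𝔽₂`. -/
def bz (b : Bool) : ZMod 2 := if b then 1 else 0

/-- `bz true = 1`. -/
@[simp] theorem bz_true : bz true = 1 := rfl

/-- `bz false = 0`. -/
@[simp] theorem bz_false : bz false = 0 := rfl

/-- `bz` turns `xor` into addition. -/
theorem bz_xor (a b : Bool) : bz (xor a b) = bz a + bz b := by
  cases a <;> cases b <;> decide

/-- `bz` is injective. -/
theorem bz_injective : Function.Injective bz := by
  intro a b h
  cases a <;> cases b <;> first | rfl | exact absurd h (by decide)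

/-- Every element of `𝔽₂` is a `bz`. -/
theorem bz_decide_eq_one (c : ZMod 2) : bz (decide (c = 1)) = c := by
  fin_cases c <;> decide

/-- The `𝔽₂`-vector of a Boolean string. -/
def vecOf (y : Fin m → Bool) : Fin m → ZMod 2 := fun j => bz (y j)

/-- `vecOf` is injective. -/
theorem vecOf_injective : Function.Injective (vecOf (m := m)) := fun _ _ h =>
  funext fun j => bz_injective (congrFun h j)

/-- `vecOf` turns pointwise `xor` into addition. -/
theorem vecOf_xor (y z : Fin m → Bool) : vecOf (fun j => xor (y j) (z j)) = vecOf y + vecOf z := by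
  funext j; exact bz_xor _ _

/-! ## Boundary, coboundary, cycles of the XOR multigraph -/

/-- The boundary of an edge vector: `(∂λ)_v = Σ_j λ_j·([a_j = v] + [b_j = v])`. -/
def xorBoundary (I : LocalMap 4 n m) (lam : Fin m → ZMod 2) : Fin n → ZMod 2 :=
  fun v => ∑ j, lam j * ((if I.vars j 0 = v then 1 else 0) + (if I.vars j 1 = v then 1 else 0))

/-- `λ` is a CYCLE (even edge set) of the XOR multigraph: zero boundary at every vertex. -/
def IsXorCycle (I : LocalMap 4 n m) (lam : Fin m → ZMod 2) : Prop := xorBoundary I lam = 0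

/-- The coboundary (cut) map: `(δw)_j = w_{a_j} + w_{b_j}`. -/
def xorCoboundary (I : LocalMap 4 n m) : (Fin n → ZMod 2) →ₗ[ZMod 2] (Fin m → ZMod 2) where
  toFun w := fun j => w (I.vars j 0) + w (I.vars j 1)
  map_add' w w' := by funext j; simp only [Pi.add_apply]; ring
  map_smul' c w := by funext j; simp only [Pi.smul_apply, smul_eq_mul, RingHom.id_apply]; ring

/-- The `𝔽₂`-indicator of a vertex set. -/
def indVec (T : Finset (Fin n)) : Fin n → ZMod 2 := fun v => if v ∈ T then 1 else 0

/-- `bz` of a decision is the `𝔽₂`-indicator. -/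
theorem bz_decide (p : Prop) [Decidable p] : bz (decide p) = if p then 1 else 0 := by
  by_cases h : p <;> simp [h]

/-- Cut vectors are coboundaries of indicators. -/
theorem vecOf_cutVec (I : LocalMap 4 n m) (T : Finset (Fin n)) : vecOf (cutVec I T) = xorCoboundary I (indVec T) := by
  funext j
  simp only [vecOf, cutVec, xorCoboundary, LinearMap.coe_mk, AddHom.coe_mk, indVec, bz_xor, bz_decide]

/-- Every coboundary is a cut vector (every `𝔽₂`-vector is an indicator). -/
theorem exists_cutVec_of_mem_range (I : LocalMap 4 n m) (z : Fin m → ZMod 2)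
    (hz : z ∈ LinearMap.range (xorCoboundary I)) : ∃ T : Finset (Fin n), z = vecOf (cutVec I T) := by
  obtain ⟨w, rfl⟩ := hz
  refine ⟨univ.filter fun v => w v = 1, ?_⟩
  rw [vecOf_cutVec]
  congr 1
  funext v
  simp only [indVec, Finset.mem_filter, Finset.mem_univ, true_and]
  have := bz_decide_eq_one (w v)
  unfold bz at this
  rw [← this]
  by_cases h : w v = 1 <;> simp [h]

/-- **Duality** `⟪δw, λ⟫ = ⟪w, ∂λ⟫`. -/
theorem dot_coboundary (I : LocalMap 4 n m) (w : Fin n → ZMod 2) (lam : Fin m → ZMod 2) :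
    xorCoboundary I w ⬝ᵥ lam = w ⬝ᵥ xorBoundary I lam := by
  simp only [dotProduct, xorCoboundary, LinearMap.coe_mk, AddHom.coe_mk, xorBoundary]
  have hsel : ∀ (u : Fin n), ∑ v, w v * (if u = v then (1 : ZMod 2) else 0) = w u := by
    intro u
    rw [Finset.sum_eq_single u (fun v _ hv => by simp [Ne.symm hv]) (by simp)]
    simp
  calc ∑ j, (w (I.vars j 0) + w (I.vars j 1)) * lam j
      = ∑ j, lam j * (∑ v, w v * (if I.vars j 0 = v then (1 : ZMod 2) else 0) +
          ∑ v, w v * (if I.vars j 1 = v then (1 : ZMod 2) else 0)) := by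
        refine Finset.sum_congr rfl fun j _ => ?_
        rw [hsel, hsel]; ring
    _ = ∑ j, ∑ v, w v * (lam j * ((if I.vars j 0 = v then (1 : ZMod 2) else 0) +
          (if I.vars j 1 = v then (1 : ZMod 2) else 0))) := by
        refine Finset.sum_congr rfl fun j _ => ?_
        rw [← Finset.sum_add_distrib, Finset.mul_sum]
        refine Finset.sum_congr rfl fun v _ => ?_
        ring
    _ = ∑ v, w v * ∑ j, lam j * ((if I.vars j 0 = v then (1 : ZMod 2) else 0) +
          (if I.vars j 1 = v then (1 : ZMod 2) else 0)) := by
        rw [Finset.sum_comm]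
        refine Finset.sum_congr rfl fun v _ => ?_
        rw [Finset.mul_sum]

/-- Cut vectors are orthogonal to cycles. -/
theorem dot_eq_zero_of_cycle (I : LocalMap 4 n m) (w : Fin n → ZMod 2) (lam : Fin m → ZMod 2)
    (h : IsXorCycle I lam) : xorCoboundary I w ⬝ᵥ lam = 0 := by
  rw [dot_coboundary, h, dotProduct_zero]

/-- A linear functional on `𝔽₂^m` is the pairing with its values on the unit vectors. -/
theorem dual_apply_eq_dotProduct (f : Module.Dual (ZMod 2) (Fin m → ZMod 2)) (z : Fin m → ZMod 2) :
    f z = z ⬝ᵥ fun j => f (Pi.single j 1) := by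
  conv_lhs => rw [show z = ∑ j, z j • (Pi.single j (1 : ZMod 2) : Fin m → ZMod 2) from by
    funext a; simp [Finset.sum_apply, Pi.single_apply]]
  rw [map_sum]
  unfold dotProduct
  exact Finset.sum_congr rfl fun j _ => by rw [map_smul, smul_eq_mul]

/-- **`Cut(G_L) = Cycle(G_L)^⊥`**: an edge vector is a coboundary iff it is orthogonal to every cycle. -/
theorem mem_range_coboundary_iff_orth (I : LocalMap 4 n m) (z : Fin m → ZMod 2) :
    z ∈ LinearMap.range (xorCoboundary I) ↔ ∀ lam : Fin m → ZMod 2, IsXorCycle I lam → z ⬝ᵥ lam = 0 := by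
  constructor
  · rintro ⟨w, rfl⟩ lam hlam
    exact dot_eq_zero_of_cycle I w lam hlam
  · intro h
    by_contra hz
    obtain ⟨f, hf, hfU⟩ := Submodule.exists_dual_map_eq_bot_of_notMem hz inferInstance
    set lam : Fin m → ZMod 2 := fun j => f (Pi.single j 1) with hlam
    -- `f` kills every coboundary, so `lam` is a cycle
    have hkill : ∀ w : Fin n → ZMod 2, xorCoboundary I w ⬝ᵥ lam = 0 := by
      intro w
      have hmem : f (xorCoboundary I w) ∈ (LinearMap.range (xorCoboundary I)).map f :=
        Submodule.mem_map_of_mem ⟨w, rfl⟩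
      rw [hfU, Submodule.mem_bot, dual_apply_eq_dotProduct] at hmem
      exact hmem
    have hcyc : IsXorCycle I lam := by
      funext v
      have h1 := hkill (Pi.single v 1)
      rw [dot_coboundary] at h1
      simpa [dotProduct, Pi.single_apply] using h1
    have h0 := h lam hcyc
    rw [← dual_apply_eq_dotProduct] at h0
    exact hf h0

/-! ## Typed range membership and avoidance through cycles -/

/-- **Cycle form of `Range = Cut ⊕ Clique`.**  For a typed pure `P⋆` instance, `y ∈ Range` iff for some vertex set `S` of
the AND graph the vector `y ⊕ cliqueVec S` is orthogonal to every cycle of the XOR multigraph. -/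
theorem mem_range_typed_iff_cycle (I : LocalMap 4 n m) (hI : I.IsPure xorAndPred) (hT : Typed I) (y : Fin m → Bool) :
    y ∈ I.range ↔ ∃ S : Finset (Fin n), ∀ lam : Fin m → ZMod 2, IsXorCycle I lam →
      vecOf (fun j => xor (y j) (cliqueVec I S j)) ⬝ᵥ lam = 0 := by
  rw [mem_range_typed_iff I hI hT y]
  constructor
  · rintro ⟨T, S, rfl⟩
    refine ⟨S, ?_⟩
    rw [← mem_range_coboundary_iff_orth]
    have hvec : vecOf (fun j => xor (xor (cutVec I T j) (cliqueVec I S j)) (cliqueVec I S j)) = vecOf (cutVec I T) := by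
      congr 1; funext j; cases cutVec I T j <;> cases cliqueVec I S j <;> rfl
    rw [hvec, vecOf_cutVec]
    exact ⟨_, rfl⟩
  · rintro ⟨S, hS⟩
    rw [← mem_range_coboundary_iff_orth] at hS
    obtain ⟨T, hTz⟩ := exists_cutVec_of_mem_range I _ hS
    refine ⟨T, S, funext fun j => ?_⟩
    have hj : xor (y j) (cliqueVec I S j) = cutVec I T j := congrFun (vecOf_injective hTz) j
    rw [← hj]
    cases y j <;> cases cliqueVec I S j <;> rfl

/-- **Cycle form of typed AVOID.**  For a typed pure `P⋆` instance, `y ∉ Range` iff for EVERY vertex set `S` of the AND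
graph some cycle `λ` of the XOR multigraph has odd overlap with `y ⊕ cliqueVec S`: `⟪y ⊕ cliqueVec S, λ⟫ = 1`.  (Typed
`P⋆`-AVOID is avoidance for the quadratic map `S ↦ (⟪cliqueVec S, λ⟫)_λ` over the cycle space.) -/
theorem not_mem_range_typed_iff_cycle (I : LocalMap 4 n m) (hI : I.IsPure xorAndPred) (hT : Typed I)
    (y : Fin m → Bool) :
    y ∉ I.range ↔ ∀ S : Finset (Fin n), ∃ lam : Fin m → ZMod 2, IsXorCycle I lam ∧
      vecOf (fun j => xor (y j) (cliqueVec I S j)) ⬝ᵥ lam = 1 := by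
  rw [mem_range_typed_iff_cycle I hI hT y]
  push Not
  refine forall_congr' fun S => exists_congr fun lam => and_congr_right fun _ => ?_
  generalize vecOf (fun j => xor (y j) (cliqueVec I S j)) ⬝ᵥ lam = c
  constructor
  · intro h
    fin_cases c
    · exact absurd rfl h
    · rfl
  · intro h h0; rw [h0] at h; exact absurd h (by decide)

end Summit.PneNP.PneNP.Theorems.PstarTypedCycle
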